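import Summits.Ventures.PercRepro.Night2BasisFaceMass
import Summits.Ventures.PercRepro.Night2BasisCountSum

/-!
# night-2: the (2,1) cell of h21 from the typed floors and the face sums

`faceSum T = Σ_{B thin, |B ∖ K| = 4, B ⊆ T} phiFace B · |(T ∖ K) ∖ clF B|` bounds `D · pi2MassH T`
(`pi2MassH_le_face_sum`), so the basis pairs' fair share at a lossy basis pair follows from
`1 ≤ Σ_{T ∈ tgtSets B z} vType T / faceSum T` (`basis_pair_fair_of_face_sum`), and the local Hall inequality of the
cell from these FACE SUMS alone (`localShadowHall_of_face_sums`) — the twin of `localShadowHall_of_count_sums` whose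
mass side sees only the hyperplane sizes of the four-point members (numerics: 3.2 … 3.5 on the hardest instances,
paper NIGHT-2-g31 §3.2 (b′)).
-/

namespace PercRepro.Shadow

open PercRepro.ThmH PercRepro.PerFlat

variable {α : Type*} [DecidableEq α] {M : Matroid α} [M.Finite] {G : Finset α}

/-- The face sum of a target: `Σ_{B thin, |B ∖ K| = 4, B ⊆ T} phiFace B · |(T ∖ K) ∖ clF B|`. -/
noncomputable def faceSum (M : Matroid α) [M.Finite] (G T : Finset α) : ℚ :=
  ∑ B ∈ (thinMembers M 5 G).filter (fun B => ¬ bigP M G B ∧ B ⊆ T),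
    phiFace M B * (((T \ coloops M G) \ clF M B).card : ℚ)

/-- **The basis pairs' fair share from the typed floors and the face sums**: `1 ≤ Σ_T vType T / faceSum T`. -/
theorem basis_pair_fair_of_face_sum (hG : G ∈ flatsQ M (5 + 1)) (hd : (gr M \ G).card = 2)
    (hk : kColoops M G = 1) (hs : ∀ e ∈ gr M, ∀ f ∈ gr M, e ≠ f → rkN M {e, f} = 2)
    (hl : ∀ e ∈ gr M, M.Indep {e}) (hfat : (fatClosures M 5 G 2).card ≤ 1)
    {B : Finset α} (hB : B ∈ thinMembers M 5 G) (hnP : ¬ bigP M G B) {z : α} (hz : z ∈ G \ clF M B)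
    (hl0 : loss M 5 G B z ≠ 0)
    (hsum : 1 ≤ ∑ T ∈ tgtSets M 5 G B z, vType M G T / faceSum M G T) :
    loss M 5 G B z ≤ rhoL M 5 G B z * lossIncomeH M 5 G (bigP M G) (dshGT2 M 5 G) B z := by
  have hd' : (gr M \ G).card ≤ 5 := by omega
  have hB4 := card_sdiff_eq_four_of_not_bigP hG hd hk hB hnP
  set D : ℚ := ((2 ^ (G.card - 6) - 1 : ℕ) : ℚ) with hD
  have hDpos : 0 < D := by
    rw [hD]
    have h7 : 7 ≤ G.card := by
      have hKB : coloops M G ⊆ B := coloops_subset_of_mem_thinMembers hG hd' hB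
      have hBG : B ⊆ G := subset_G_of_mem_thinMembers hB
      have h1 := Finset.card_sdiff_add_card_eq_card hKB
      rw [← kColoops_eq_card_coloops, hk] at h1
      have h2 := two_le_card_sdiff_of_not_lay0 hG hd' (mem_thinMembers.1 hB).1 (mem_thinMembers.1 hB).2
      have hdisj : Disjoint B (G \ clF M B) := by
        rw [Finset.disjoint_left]
        intro a ha ha'
        exact (Finset.mem_sdiff.1 ha').2 (subset_clF_of_subset_gr (hBG.trans (mem_flatsQ.1 hG).1) ha)
      have h3 := Finset.card_le_card (Finset.union_subset hBG (Finset.sdiff_subset : G \ clF M B ⊆ G))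
      rw [Finset.card_union_of_disjoint hdisj] at h3
      omega
    have : 2 ≤ 2 ^ (G.card - 6) := by
      calc 2 = 2 ^ 1 := by norm_num
        _ ≤ 2 ^ (G.card - 6) := Nat.pow_le_pow_right (by norm_num) (by omega)
    exact_mod_cast (by omega : 0 < 2 ^ (G.card - 6) - 1)
  have hrho : rhoL M 5 G B z = loss M 5 G B z / D := by
    unfold rhoL
    rw [card_tgtSets hG (mem_thinMembers.1 hB).1 hz,
      card_sdiff_insert_eq_dqm1 (ρ := 5) hG hd' hB (by omega) hz, hk]
    have hcard : G.card - 1 - 5 = G.card - 6 := by omega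
    rw [hcard]
  set u : Finset α → ℚ := fun T => faceSum M G T / D with hu
  have hmass : ∀ T ∈ tgtSets M 5 G B z, pi2MassH M 5 G (bigP M G) T ≤ u T := fun T hT =>
    pi2MassH_le_face_sum hG hd hk (subset_G_of_mem_shadowAt (mem_tgtSets.1 hT).1)
      (coloops_subset_of_mem_shadowAt (mem_tgtSets.1 hT).1)
  have hinc := lossIncomeH_ge_of_subfamily hG hd' (column_side_gt2 hG hd hk hs hl hfat) hB hnP hz hl0
    (Finset.Subset.refl _) u (vType M G) hmass
    (fun _ hT => vType_le_cap3 hG hd hk hs hl hfat (subset_G_of_mem_shadowAt (mem_tgtSets.1 hT).1)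
      (coloops_subset_of_mem_shadowAt (mem_tgtSets.1 hT).1)) (fun _ _ => vType_nonneg _)
  have hsplit : ∑ T ∈ tgtSets M 5 G B z, vType M G T / u T = D * ∑ T ∈ tgtSets M 5 G B z,
      vType M G T / faceSum M G T := by
    rw [Finset.mul_sum]
    apply Finset.sum_congr rfl
    intro T _
    simp only [hu]
    by_cases hc : faceSum M G T = 0
    · rw [hc]
      simp
    · field_simp
  have hD' : D ≤ ∑ T ∈ tgtSets M 5 G B z, vType M G T / u T := by
    rw [hsplit]
    have := mul_le_mul_of_nonneg_left hsum hDpos.le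
    linarith
  rw [hrho]
  have hloss0 : 0 ≤ loss M 5 G B z := loss_nonneg (le_trans (by norm_num)
    (capS_ge_eleven_eighteenths_two_one hd hk (Finset.insert_subset (Finset.mem_sdiff.1 hz).1
      (subset_G_of_mem_thinMembers hB))))
  calc loss M 5 G B z = loss M 5 G B z / D * D := by field_simp
    _ ≤ loss M 5 G B z / D * lossIncomeH M 5 G (bigP M G) (dshGT2 M 5 G) B z := by
        apply mul_le_mul_of_nonneg_left (hD'.trans hinc)
        exact div_nonneg hloss0 hDpos.le

/-- **The (2,1) cell of h21 from the face sums alone**: for every lossy basis pair `1 ≤ Σ_T vType T / faceSum T`. -/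
theorem localShadowHall_of_face_sums (hG : G ∈ flatsQ M (5 + 1)) (hd : (gr M \ G).card = 2)
    (hk : kColoops M G = 1) (hs : ∀ e ∈ gr M, ∀ f ∈ gr M, e ≠ f → rkN M {e, f} = 2)
    (hl : ∀ e ∈ gr M, M.Indep {e}) (hfat : (fatClosures M 5 G 2).card ≤ 1)
    (hsum : ∀ B ∈ thinMembers M 5 G, ¬ bigP M G B → ∀ z ∈ G \ clF M B, loss M 5 G B z ≠ 0 →
      1 ≤ ∑ T ∈ tgtSets M 5 G B z, vType M G T / faceSum M G T) :
    LocalShadowHall M 5 G := by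
  apply localShadowHall_of_gt2_of_basis_fair hG hd hk hs hl hfat
  intro B hB hnP z hz
  by_cases hl0 : loss M 5 G B z = 0
  · rw [hl0]
    have hd' : (gr M \ G).card ≤ 5 := by omega
    have h1 : 0 ≤ rhoL M 5 G B z := by
      unfold rhoL
      rw [hl0]
      simp
    have h2 : 0 ≤ lossIncomeH M 5 G (bigP M G) (dshGT2 M 5 G) B z :=
      lossIncomeH_nonneg hG hd' (column_side_gt2 hG hd hk hs hl hfat) B z
    positivity
  · exact basis_pair_fair_of_face_sum hG hd hk hs hl hfat hB hnP hz hl0 (hsum B hB hnP z hz hl0)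

/-- `phiFace` vanishes at a thin member whose closure misses at least eight points of `G`: `req ≤ 7/60 < 11/90`. -/
theorem phiFace_eq_zero_of_eight_le (hG : G ∈ flatsQ M (5 + 1)) (hd : (gr M \ G).card = 2) {B : Finset α}
    (hB : B ∈ thinMembers M 5 G) (h8 : 8 ≤ (G \ clF M B).card) : phiFace M B = 0 := by
  unfold phiFace
  rw [req_eq_of_thin hG hB, hd]
  have h8' : (8 : ℚ) ≤ ((G \ clF M B).card : ℚ) := by exact_mod_cast h8
  apply max_eq_left
  unfold phiQ
  rw [sub_nonpos, div_le_iff₀ (by linarith)]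
  linarith

/-- `phiFace ≤ 61/360` at every thin member (`req ≤ 7/24`). -/
theorem phiFace_le (hG : G ∈ flatsQ M (5 + 1)) (hd : (gr M \ G).card = 2) {B : Finset α}
    (hB : B ∈ thinMembers M 5 G) : phiFace M B ≤ 61 / 360 := by
  unfold phiFace
  have := req_le_seven_div_24_of_thin hG hd hB
  apply max_le (by norm_num)
  linarith

/-- **The typed floor at an unloaded target is at least `199/360 − |coloops (T ∖ K)| · 7/30`** (`L1_le_of_fatClosures_le_one`). -/
theorem vType_ge_of_dload_eq_zero (hG : G ∈ flatsQ M (5 + 1)) (hd : (gr M \ G).card = 2) (hk : kColoops M G = 1)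
    (hfat : (fatClosures M 5 G 2).card ≤ 1) {T : Finset α} (hTG : T ⊆ G) (hKT : coloops M G ⊆ T)
    (h0 : dload M 5 G (bigP M G) (dshGT2 M 5 G) T = 0) :
    199 / 360 - ((coloops M (T \ coloops M G)).card : ℚ) * (7 / 30) ≤ vType M G T := by
  have hL1 := L1_le_of_fatClosures_le_one hG hd hk hfat hTG hKT
  unfold vType
  rw [if_pos h0]
  split_ifs with h1
  · have : (0 : ℚ) ≤ ((coloops M (T \ coloops M G)).card : ℚ) := Nat.cast_nonneg _
    linarith
  · refine le_trans ?_ (le_max_right _ _)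
    linarith

end PercRepro.Shadow
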